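import Literature.AnabelianGeometry.AbsoluteAnabelian.AbsTopITemperedCusps
import HarnessLib

/-!
# [AbsTopI] Prop 4.10 (vi) AS TYPED (`CuspsViaEdgeLike`; FACT-LIST F-0254): a characterisation predicate over
# declared data — satisfiable, rigid, and its universal closure is refutable

S. Mochizuki, *Topics in Absolute Anabelian Geometry I: Generalities*, J. Math. Sci. Univ. Tokyo 19 (2012)
[MochizukiAbsTopI2012], Prop 4.10 (vi), manuscript p. 61 (lit key `paper:url-11ac98ba15fc`): "the set of cusps
of the covering of `X_k̄` corresponding to `H` may be characterized ["group-theoretically"] as the set of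
conjugacy classes in `H[l]` of the commensurators in `H[l]` of the images in `H[l]` of edge-like subgroups of
`J[l]` [...] which are not contained in edge-like subgroups of `H[l]`" (cited by [IUTchII] p. 68).

PROOF-ONLY file (no definition, no instance, no named fact) next to abc-iut-L4's statement file
`AbsTopITemperedCusps.lean`, abc-iut cell seat abc-iut-f-091 (FACT-LIST row **F-0254** `CuspsViaEdgeLike`, class
`preparatory`, status `fact-open`, kernel_closedness `parametrised`).

The typed row is the PREDICATE `CuspsViaEdgeLike edgeH Jl ι edgeJ cuspsHl : Prop` on abstract DECLARED data —
a group `H[l]`, its edge-like subgroups `edgeH`, a family `ι_i : J_i[l] → H[l]` with edge-like subgroups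
`edgeJ i`, and a declared set `cuspsHl` of cuspidal decomposition groups — saying `cuspsHl` EQUALS the
conjugacy-closure of the candidate subgroups `cuspidalCandidates (ι i) (edgeJ i) edgeH`.  Nothing ties
`cuspsHl` to the other data, so:

* `cuspsViaEdgeLike_iff` — the predicate is literally that equation;
* `cuspsViaEdgeLike_candidateClosure` — it is SATISFIED by the candidate-closure itself (for any data): the
  printed sentence, read as a DEFINITION of the cusp set from `(H[l], J[l], edge-like subgroups)`, always has a
  (unique) solution — `CuspsViaEdgeLike.unique`; and the solution is conjugation-stable
  (`CuspsViaEdgeLike.conj_smul_mem`), as a "set of conjugacy classes" must be;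
* `not_cuspsViaEdgeLike_of_isEmpty` / `not_forall_cuspsViaEdgeLike` — with NO open subgroups `J` declared
  (`ι_idx` empty) the candidate-closure is empty, so any nonempty declared cusp set violates the predicate:
  the universal closure over all data is false (witness: `H[l] = 1`, `cuspsHl = {1}`).

So F-0254 is admissible only AT NAMED INSTANCES (the data "arising from" a hyperbolic orbicurve over an MLF
and its tempered fundamental group, which the tree does not construct): FACT-LIST class «universal closure
REFUTED / schema; instance forms open».  HONEST FRAMING: [AbsTopI] is a refereed, undisputed paper and nothing
here says Prop 4.10 (vi) is wrong; nothing here bears on the disputed [IUTchIII] Cor. 3.12 or takes a side on any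
author; typed ≠ proved.
-/

open scoped Pointwise

universe u

namespace Literature.AnabelianGeometry.AbsoluteAnabelian

variable {Hl : Type u} [Group Hl] {edgeH : Set (Subgroup Hl)} {ι_idx : Type u} {Jl : ι_idx → Type u}
  [∀ i, Group (Jl i)] {ι : ∀ i, Jl i →* Hl} {edgeJ : ∀ i, Set (Subgroup (Jl i))}
  {cuspsHl : Set (Subgroup Hl)}

/-- The typed Prop 4.10 (vi) is the equation "declared cusp set = conjugacy-closure of the candidates"
(unfolding). [cite: MochizukiAbsTopI2012, Prop 4.10 (vi) p.61] -/
theorem cuspsViaEdgeLike_iff :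
    CuspsViaEdgeLike edgeH Jl ι edgeJ cuspsHl ↔
      cuspsHl = {D | ∃ (i : ι_idx) (g : Hl), ∃ D₀ ∈ cuspidalCandidates (ι i) (edgeJ i) edgeH,
        D = MulAut.conj g • D₀} :=
  Iff.rfl

variable (edgeH Jl ι edgeJ) in
/-- **F-0254, satisfiable for every datum**: the conjugacy-closure of the candidate cuspidal subgroups itself
satisfies the typed Prop 4.10 (vi) — read as a group-theoretic DEFINITION of the cusp set, the printed
characterisation always has a solution. [cite: MochizukiAbsTopI2012, Prop 4.10 (vi) p.61] -/
theorem cuspsViaEdgeLike_candidateClosure :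
    CuspsViaEdgeLike edgeH Jl ι edgeJ
      {D | ∃ (i : ι_idx) (g : Hl), ∃ D₀ ∈ cuspidalCandidates (ι i) (edgeJ i) edgeH,
        D = MulAut.conj g • D₀} :=
  rfl

/-- ... and the solution is UNIQUE: two declared cusp sets satisfying the typed Prop 4.10 (vi) for the same
data coincide ("may be characterized"). [cite: MochizukiAbsTopI2012, Prop 4.10 (vi) p.61] -/
theorem CuspsViaEdgeLike.unique {cuspsHl' : Set (Subgroup Hl)}
    (h : CuspsViaEdgeLike edgeH Jl ι edgeJ cuspsHl) (h' : CuspsViaEdgeLike edgeH Jl ι edgeJ cuspsHl') :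
    cuspsHl = cuspsHl' :=
  (cuspsViaEdgeLike_iff.mp h).trans (cuspsViaEdgeLike_iff.mp h').symm

/-- A declared cusp set satisfying the typed Prop 4.10 (vi) is stable under `H[l]`-conjugation (it is a union
of conjugacy classes: "the set of conjugacy classes in `H[l]` of ..."). [cite: MochizukiAbsTopI2012, Prop 4.10 (vi) p.61] -/
theorem CuspsViaEdgeLike.conj_smul_mem (h : CuspsViaEdgeLike edgeH Jl ι edgeJ cuspsHl)
    {D : Subgroup Hl} (hD : D ∈ cuspsHl) (g : Hl) : MulAut.conj g • D ∈ cuspsHl := by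
  rw [cuspsViaEdgeLike_iff.mp h] at hD ⊢
  obtain ⟨i, g', D₀, hD₀, rfl⟩ := hD
  exact ⟨i, g * g', D₀, hD₀, by rw [map_mul, mul_smul]⟩

/-- Every member of a declared cusp set satisfying the typed Prop 4.10 (vi) is conjugate to a candidate coming
from SOME declared open subgroup `J` — in particular the index family of `J`'s is nonempty as soon as there is
a cusp. [cite: MochizukiAbsTopI2012, Prop 4.10 (vi) p.61] -/
theorem CuspsViaEdgeLike.nonempty_index (h : CuspsViaEdgeLike edgeH Jl ι edgeJ cuspsHl)
    (hne : cuspsHl.Nonempty) : Nonempty ι_idx := by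
  obtain ⟨D, hD⟩ := hne
  rw [cuspsViaEdgeLike_iff.mp h] at hD
  obtain ⟨i, -, -, -, -⟩ := hD
  exact ⟨i⟩

/-- With NO open subgroups `J ⊆ H` declared (empty index family) the candidate-closure is empty, so a
nonempty declared cusp set violates the typed Prop 4.10 (vi). [cite: MochizukiAbsTopI2012, Prop 4.10 (vi) p.61] -/
theorem not_cuspsViaEdgeLike_of_isEmpty [IsEmpty ι_idx] (hne : cuspsHl.Nonempty) :
    ¬ CuspsViaEdgeLike edgeH Jl ι edgeJ cuspsHl :=
  fun h => (h.nonempty_index hne).elim fun i => IsEmpty.false i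

/-- **FACT-LIST F-0254, universal closure REFUTED** (universe `0`): the typed [AbsTopI] Prop 4.10 (vi)
(`CuspsViaEdgeLike`) does not hold for ALL declared data — witness: `H[l] = 1` (the trivial group), no edge-like
subgroups, the EMPTY family of open subgroups `J` (`J[l] := 1`), and the declared cusp set `{1}`; the
candidate-closure is `∅`.
The row is a characterisation predicate, admissible only at named instances (none constructed in the tree);
its consistency is `cuspsViaEdgeLike_candidateClosure`. [cite: MochizukiAbsTopI2012, Prop 4.10 (vi) p.61] -/
theorem not_forall_cuspsViaEdgeLike :
    ¬ ∀ (Hl : Type) [Group Hl] (edgeH : Set (Subgroup Hl)) (ι_idx : Type) (Jl : ι_idx → Type)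
        [∀ i, Group (Jl i)] (ι : ∀ i, Jl i →* Hl) (edgeJ : ∀ i, Set (Subgroup (Jl i)))
        (cuspsHl : Set (Subgroup Hl)), CuspsViaEdgeLike edgeH Jl ι edgeJ cuspsHl := by
  intro H
  have h := H PUnit ∅ PEmpty (fun _ => PUnit) (fun _ => MonoidHom.id PUnit) (fun _ => ∅) {⊥}
  exact not_cuspsViaEdgeLike_of_isEmpty (Set.singleton_nonempty _) h

end Literature.AnabelianGeometry.AbsoluteAnabelian
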